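import Mathlib
import HarnessLib
import HarnessLib.Audit
import Summits.PneNP.Statement
import Literature.Computability.Complexity.ConstantDepth
import Literature.Computability.Complexity.ProbabilisticClasses
import Literature.Computability.Complexity.Classes
import Literature.Computability.Complexity.Nondeterministic
import Literature.Computability.Complexity.Randomized
import Literature.Computability.MetaComplexity.UniversalMachine
import Literature.Computability.MetaComplexity.UniversalMachineProofs
import Literature.Computability.Cryptography.CryptoFoundationsKolmogorov
import Literature.Computability.Cryptography.CryptoFoundationsKolmogorovProofs
import Literature.Computability.Complexity.CookBridges
import HarnessLib.Audit.Status.Attr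

/-!
Route: ktlang

DORMANT since 2026-08-21T17:29:29Z (reconciler: no traction for 5 d (last activity item-proof-filed at 2026-08-16T17:01:51Z); parked, not closed — `ledger route dormant route-PneNP-ktlang --off` to reactivate) — unstaffed, not closed; items shared with open routes are served there. `ledger route dormant <id> --off` reactivates.

# Route ktlang — meta-complexity: a K^t threshold language MK^tP[s] is not in P (worst-case rung of
the Liu–Pass / Hirahara programme)

It suffices to show X: for every efficient universal machine U (structure
`Literature.Computability.MetaComplexity.UniversalMachine`, Liu–Pass's standing conventions; the
interface is inhabited by the
PROVED construction fact `UniversalMachine.nonempty_holds`, Hennie–Stearns) there are polynomials t,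
s such that the exact threshold
language MK^tP[s] = {x : K^t_U(x) ≤ s(|x|)} of time-bounded Kolmogorov complexity
(`UniversalMachine.MKtimeP`, LiuPass2020 §2.2) is not
decidable in polynomial time (`Classes.P`). X is ONE statement, the item `KtlangThesis`, and it is
the only hypothesis of the deciding
theorem; MK^tP[s] ∈ NP holds unconditionally and is PROVED in tree (`MKtimeP_mem_NP_holds`), so X
exhibits an explicit language in NP ∖ P.
The route realises no idea card (opened 2026-08-13, before the card index); its cruxes #2/#4/#5 are
the three handles by which the
meta-complexity programme attacks or cashes X (randomized NP-hardness, worst-case→io-one-wayness,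
constant-depth lower bounds).
Lean: `∀ U : Literature.Computability.MetaComplexity.UniversalMachine, ∃ (t s : Polynomial ℕ),
U.MKtimeP (fun n => t.eval n) (fun n => s.eval n) ∉ Literature.Computability.Complexity.Classes.P`

## Assembly
Pure logic plus two PROVED facts and two PROVED model bridges, no Literature-fact hypothesis: the
deciding theorem (D-0027 §2.1)
`theorem closes (hX : KtlangThesis) : PneNP` picks U from `UniversalMachine.nonempty_holds`
(UniversalMachineProofs), takes the (t, s) of X,
gets MK^tP[s] ∈ NP from `MKtimeP_mem_NP_holds` (CryptoFoundationsKolmogorovProofs; LiuPass2020 §2.2)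
and ∉ P from X, and transports the pair
to Cook's classes by `CookBridges.np_bool_eq` and `p_bool_eq` (CookBridges.lean, below no open
conjecture). It is sorry-free with axioms
{propext, Classical.choice, Quot.sound} and natively certified (h21_check_closes OK, 2026-08-16).
The Assembly ITEM below is the same
implication as a statement; it is provable now as `fun hX => closes hX` and is kept only because a
route carries exactly one assembly item.

Rationale: WHY THIS LINE. The line replaces SAT by an information-theoretic witness — incompressibility of
uniformly random strings within a time budget — and files the
WORST-CASE rung of the Liu–Pass / Hirahara programme as one ∀U fixed-threshold language over one
interface. Three imports from Kolmogorov
complexity and cryptography make it more than a renaming of P ≠ NP: (i) LiuPass2020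
(arXiv:2009.11514, Thm 1.1, pp. 3–4; PROVED in tree as
`OWFExist_iff_isMildlyHardOnAverage_liuPassKt_holds`) — mild average-case hardness of K^t (t ≥ 2n) ⇔
one-way functions, and OWF ⇒ worst-case
hardness of K^poly (ibid. p. 4 via KabanetsCai2000 / ABK+ doi:10.1109/SFCS.2002.1181992), so ¬X for
one U already refutes OWF; (ii) Hirahara's
NON-black-box worst-case→average-case reductions for Gap-K^t (Hirahara2018) and the NP-hardness of
partial / distributional / oracle variants
(Hirahara2022, Hirahara2023 doi:10.1145/3564246.3585130 Thm 1.2, AllenderHirahara2019) —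
non-relativizing in the reduction sense because they use
the code and running time of U and of the hypothetical solver; (iii) the PRG dictionary K^t-hardness
↔ OWF ↔ PRG (KabanetsCai2000, ABK+) that
turns the constant-depth rung into a PRG-against-ACC⁰ question. What it does that other routes do
not: sibling route-PneNP-MetaCplx carries the
AVERAGE-CASE (OWF-valued) thesis and Ko's parametrised MINKT; this route is the worst-case
exact-threshold language with a conjecture-free,
debt-free import cone and a certified deciding theorem `closes : KtlangThesis → PneNP`; the
negatives index (5 refuted PneNP statements) has
nothing near K^t.

RANKED CRUXES. Four cruxes, ranked. Rank 0 is X itself (the single hypothesis of `closes`,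
auto-cruxed 2026-08-16 under the crux-only deciding-theorem
rule); rank 2 is the lever that would make X a consequence of NP ⊄ BPP; rank 4 cashes the BPP-form
of X as infinitely-often one-way functions
(Pessiland exclusion for exact K^t); rank 5 is the constant-depth rung. KtlangNeg (support) staffs
the negative side.
#0 KtlangThesis (crux) — Thesis X — for every efficient universal machine U some exact threshold
language MK^tP[s] (t, s polynomials) is not in P. Only hypothesis of the deciding theorem `closes`.
[difficulty: open-problem] (why it might fail: s ∈ ℕ[X] leaves only thresholds s = n + c below U's
print constant live (constant s: in P by enumeration; s ≥ n + c_U: everything); Ko1991 oracles put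
MINKT in P, so X is non-relativizing; ¬X for one U already refutes OWF (Liu–Pass + Kabanets–Cai) — X
is at least P ≠ NP-hard to prove.) [LiuPass2020 (arXiv:2009.11514) §1.1 pp. 3–5 and §2.2, Ko1991,
KabanetsCai2000, doi:10.1109/SFCS.2002.1181992 (ABK+ 2006), decl
Literature.Computability.MetaComplexity.UniversalMachine.print / ncard_setOf_ktAt_lt (threshold
regime), decl Literature.Computability.Cryptography.MKtimeP_mem_NP_holds,
doi:10.1007/978-3-032-01855-7_20 (Liu–Pass 2025 boundary hardness — acq-05706)]
#2 KtlangNpHard (crux) — For every efficient universal machine U some exact threshold language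
MK^tP[s] (t ≥ 2n; t, s polynomials) is NP-hard under two-sided randomized polynomial-time many-one
reductions reading EXACTLY q(|x|) coins (Arora–Barak Def. 7.16 in the normal form of Def. 7.3); the
reducibility is inlined over `RandAlg` and is `Iff.rfl`-equal to `∀ L' ∈ NP, PolyTimeRandReducible'
L' (U.MKtimeP t s)` (RandReductionsBPPProofs.lean), whose PROVED closure
`mem_BPP_of_polyTimeRandReducible'_holds` gives #2 ∧ (NP ⊄ BPP) → X_BPP in one line. [difficulty:
open-problem] (why it might fail: Only MCSP*/McKTP/distributional-K^t/oracle variants are known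
NP-hard (Hirahara22, LiuPass CCC22, Hirahara23, Ilango23); deterministic hardness forces EXP ≠ ZPP
(MurrayWilliams2017 Thm 1.6); Gap-MKTP is not NP-complete under randomized LEVIN reductions given
subexp iO + OWF (Mazor–Pass TR24-053).) [Hirahara2022, Hirahara2023 (doi:10.1145/3564246.3585130)
Thm 1.2 and p. 4 (Saks–Santhanam obstacle), MurrayWilliams2017 Thms 1.6/4.1, KabanetsCai2000,
HuangIlangoRen2023, doi:10.1007/978-3-030-41672-0_6 (Hirahara–Watanabe 2020 oracle-independence),
ECCC:TR24-053 (Mazor–Pass 2024 §1), doi:10.1109/focs63196.2025.00087 (Hirahara–Ilango FOCS 2025),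
decl Literature.Computability.MetaComplexity.PolyTimeRandReducible' /
mem_BPP_of_polyTimeRandReducible'_holds, decl Literature.Barriers.PneNP.MCSPKarpHardness]
#4 KtlangWorstToAvg (crux) — C3 of the 2026-08-15 route review (machine in POSITIVE position,
io-balanced conclusion): if for EVERY efficient universal machine U some exact threshold language
MK^tP[s] with t ≥ 2n is worst-case hard for BPP (X in BPP form), then infinitely-often one-way
functions exist; the conclusion `∃ f, IsIOOneWay f` (= IOOWFExist) is inlined down to `RandAlg.pr`
and a finite average so that no conjecture file is imported. [difficulty: open-problem] (why it
might fail: X_BPP is worst-case hardness of an exact K^t slice; worst→avg reductions for K^poly are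
ERRORLESS (Hirahara2018), io-OWF needs error-prone avg hardness — open (LiuPass2020 p.5,
Hirahara2023 §1.3); black-box ⇒ coNP ⊆ AM (Bogdanov–Trevisan); proved only for
depth/boundary-restricted MK^tP (Liu–Pass).) [Hirahara2018 (doi:10.1109/focs.2018.00032),
Hirahara2023 §1.3 (doi:10.1145/3564246.3585130), LiuPass2020 (arXiv:2009.11514) p. 5,
doi:10.1007/978-3-031-78011-0_8 (Liu–Pass CRYPTO 2024 Thm 1.1 io-balanced),
doi:10.1007/978-3-032-01855-7_20 (Liu–Pass 2025 — acq-05706), doi:10.4230/lipics.itcs.2026.97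
(Liu–Pass ITCS 2026), ECCC:TR24-059 (Hirahara–Kabanets–Lu–Oliveira 2024) §1.1, CCC1995
(Impagliazzo's worlds), BogdanovTrevisan2006, refuter route-review block + 5 crux attacks on
stmt-PneNP-11283 (2026-08-15: evidence CruxAttack.md / Repair.lean / Repair2.lean / Recoding.lean —
C3 recommended), decl Literature.Computability.Cryptography.pneNP_shape_of_IOOWFExist
(OneWayFunctionsPneNP.lean), decl Literature.Barriers.PneNP.NPHardnessToOneWayFunctions]
#5 KtlangAcc0 (crux) — For every efficient universal machine U some exact threshold language
MK^tP[s] with t ≥ 2n is not in ACC⁰ (the constant-depth rung of X; since MK^tP ∈ NP it implies NP ⊄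
ACC⁰). The AC⁰ analogue is the standard PRG argument (ABK+ 2006: MK^tP[s] rejects most random
strings but accepts every output of a poly-time PRG of seed length < s − O(1), and Nisan's PRG fools
AC⁰); AC⁰[p] analogues are theorems for MCSP (GIIKKT 2019). [difficulty: open-problem] (why it might
fail: Implies NP ⊄ ACC⁰ (frontier: NQP ⊄ ACC⁰, MurrayWilliams2018). The PRG/hitting-set argument
behind MCSP ∉ AC⁰, AC⁰[p] (ABK+06, GIIKKT19) needs at thresholds s = n + c a poly-time generator
unpredictable by ACC⁰ at seed < n — an average-case ACC⁰ bound for P, unknown.) [Williams2014,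
MurrayWilliams2018, doi:10.1109/SFCS.2002.1181992 (ABK+ 2006), KabanetsCai2000, ECCC:TR19-018
(GIIKKT 2019), RazborovRudich1997, decl Literature.Barriers.PneNP.NaturalProofs]
#6 KtlangNeg (support) — Negation of the thesis for one machine — some efficient universal machine U
has every MK^tP[s] (t, s polynomials) in P — filed so the negative side is staffed; `KtlangNeg ↔
¬KtlangThesis` is pure logic, and a proof refutes OWF by Liu–Pass + Kabanets–Cai and closes the
route. [difficulty: open-problem] [Ko1991, KabanetsCai2000, LiuPass2020]

TWO-LAYER PLAN. Foreseen glued splits once a crux moves (nothing filed now; k ≤ 3, depth 1):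
KtlangNpHard ⇐ GapNpHard → GapToExact → KtlangNpHard, where
GapNpHard is randomized NP-hardness of the promise problem Gap-MK^tP (definition LANDED:
`UniversalMachine.gapMKtimeP` over `PromiseProblem`,
Literature/Computability/MetaComplexity/GapMINKT.lean — the notion in which Hirahara2022-type
hardness is proved) and GapToExact the padding /
threshold-shift step; KtlangWorstToAvg ⇐ (X_BPP → errorless average-case hardness of K^t,
Hirahara2018-type, non-black-box) → (errorless →
error-prone for exact K^t, the Hirahara2023 §1.3 padding gap) → C3; KtlangAcc0 ⇐ (a poly-time
generator of seed < n unpredictable by ACC⁰) →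
(ABK+ distinguisher lemma for MK^tP[n + c]) → KtlangAcc0. The inference #2 ∧ (NP ⊄ BPP) → X_BPP is a
one-liner from
`PolyTimeRandReducible'.mem_BPP` and would be filed as support, not as a crux.

KILL CRITERIA. KtlangNeg proved for one U closes the route (`close --reason refuted:KtlangThesis`)
and is recorded as ¬OWF via Liu–Pass. KtlangNpHard refuted in
the strong form "MK^tP[s] NP-hard under randomized (non-Levin) many-one reductions ⇒ PH collapse /
EXP-type consequence / contradiction with iO"
(a Saks–Santhanam / Murray–Williams / Mazor–Pass-type theorem for plain randomized Karp reductions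
at fixed t) demotes the line to its
average-case rung: `close --reason superseded --by route-PneNP-MetaCplx`. KtlangWorstToAvg (C3)
refuted kills rank 4 only; KtlangAcc0 refuted for
all (t ≥ 2n, s) kills rank 5 only. A junk inhabitant of `UniversalMachine` on which some ∀U item
fails as stated (refuter caveats F1–F3 on
stmt-PneNP-0050) means: restate that item over the repaired interface, not a close. OWFExist proved
elsewhere (route MetaCplx /
Theorems/OWFExist.lean) proves X outright via Kabanets–Cai at the live thresholds only
machine-by-machine — it moots rank 4, not the route.

NOT DECOMPOSED YET. Deliberately not filed at this layer: the threshold regime (with s : Polynomial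
ℕ only s = n + c, 0 ≤ c < c_U, is live — finer thresholds
n − O(log n) need a richer threshold type and are a RESTATEMENT, not a child); the Gap / promise
rungs of #2 and #4 (Two-layer plan); KT / Kt /
conditional-K^t and distributional (Hirahara2023 dK) variants; the PRG-vs-ACC⁰ sub-branch of #5;
search-to-decision and symmetry-of-information
structure of K^t (ECCC:TR24-059; Liu–Pass STOC 2026 doi:10.1145/3798129.3800867). All are layer-2
material after a crux closes (D-0019).

CHEAPEST FALSIFIER. One literature lookup, re-run at every seat: a theorem "MK^tP[s] / MINKT / MKTP
NP-hard under RANDOMIZED NON-LEVIN many-one reductions for a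
natural machine ⇒ EXP ≠ ZPP, a circuit lower bound, or ¬iO" would put rank 2 inside
`Literature.Barriers.PneNP.MCSPKarpHardness` and demote the
route to MetaCplx (a machine-independent version is impossible: the planted admissible U_J of the
08-15 review has an NP-hard exact slice).
Status 2026-08-16: MurrayWilliams2017 Thm 1.6 (deterministic, length-regular), Saks–Santhanam CCC
2022 as reported in Hirahara2023 p. 4
(approximating K^t cannot be NP-hard under t′-time reductions for t′ ≪ t — consistent with a FIXED
polynomial t and slower reductions),
Hirahara–Watanabe doi:10.1007/978-3-030-41672-0_6 (oracle-independent reductions), Mazor–Pass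
ECCC:TR24-053 (randomized LEVIN reductions
under iO) — none covers plain randomized Karp reductions to an exact MK^tP[s] with fixed t. Second
cheapest, done (planner Sketch.lean rc 0,
g3 seat): C3 ↔ (X_BPP → IOOWFExist) by Iff.rfl; dropped rank 3 ⇔ OWFExist per t (proved Liu–Pass);
KtlangNeg ↔ ¬KtlangThesis is pure logic.

NUMBERS. Thresholds: with s ∈ ℕ[X] the live regime is s(n) = n + c, 0 ≤ c < c_U (c_U = U's print
constant, `UniversalMachine.print`; a slice
{x : K^t(x) < m} has < 2^m elements, `ncard_setOf_ktAt_lt`). Time bounds: t(n) ≥ 2n in #2/#4/#5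
(Liu–Pass's regime for Thm 1.1). Reduction
error 2/3 with exactly q(|x|) coins (#2). Saks–Santhanam: NP-hardness of approximating K^t under
t′-time reductions is implausible for t′ ≪ t
(Hirahara2023 p. 4) — the reductions of #2 are polynomial with no relation to t imposed.

DEFINITION REQUESTS. None outstanding: `UniversalMachine.gapMKtimeP` (Gap-MK^tP as a
`PromiseProblem`) landed in Literature/Computability/MetaComplexity/GapMINKT.lean;
`PolyTimeRandReducible'` and its proved BPP-closure live in RandReductionsBPPProofs.lean (used
inside proofs only; not imported by the route).

Novelty: Searches (2026-08-15, rev-3 seat): `lit search "time-bounded Kolmogorov complexity NP-hardness MINKT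
one-way functions"` (local 2 held:
HiraharaSanthanam2022, Hirahara2023; crossref 15, incl. Liu–Pass CRYPTO 2024
doi:10.1007/978-3-031-78011-0_8, Liu–Pass 2025
doi:10.1007/978-3-032-01855-7_20, Kabanets–Kolokolova STOC 2026 doi:10.1145/3798129.3800780); `lit
frontier PneNP --since 2023` (30 rows; Liu–Pass
ITCS 2026 doi:10.4230/lipics.itcs.2026.97, STOC 2026 doi:10.1145/3798129.3800867); `lit read
paper:arxiv-2009.11514` pp. 4, 6 and
`paper:doi-10-1145-3564246-3585130` pp. 5, 6, 18. Searches (2026-08-16, rev-4 seat): `lit search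
"NP-hardness time-bounded Kolmogorov complexity
MKtP randomized reductions one-way functions worst-case" --year-from 2023` (crossref 20: adds
Liu–Pass CRYPTO 2023 doi:10.1007/978-3-031-38545-2_21,
Ilango–Lombardi FOCS 2025 doi:10.1109/focs63196.2025.00032, AGHR TCS 2023
doi:10.1016/j.tcs.2022.10.040); `lit galaxy search "worst-case hardness of
time-bounded Kolmogorov complexity" --star all` (0); `lit galaxy search "Time-Bounded Kolmogorov
Complexity" --star pdf` (7: ECCC TR24-059, TR24-053,
TR23-152, TR23-175, LOZ22 read in part). Searches (2026-08-16, this g4 seat): `lit read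
arxiv:2009.11514 --pages 1-6 --grep worst-case` (pp. 3–5
re-read: Thm 1.1, OWF ⇒ worst-case hardness of K^poly, worst→average for erring heuristics open);
`lit read doi:10.1145/3564246.3585130 --pages 1-6`
(p. 4 Saks–Santhanam obstacle, p. 6 §1.3 padding conjecture); `lit search "N  [refs: 10.1007/978-3-031-78011-0_8, 10.1007/978-3-032-01855-7_20, 10.1145/3798129.3800780, 10.4230/lipics.itcs.2026.97, 10.1145/3798129.3800867, 10.1007/978-3-031-38545-2_21, 10.1109/focs63196.2025.00032, 10.1016/j.tcs.2022.10.040, 10.1145/3564246.3585130, 10.4230/LIPIcs.CCC.2025.34, 10.4230/LIPIcs.ICALP.2021.44, 10.1109/SFCS.2002.1181992, 2009.11514, doi:10.1007/978-3-031-78011-0_8, doi:10.1007/978-3-03]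

Barriers (technique_class: meta-complexity, NP-hardness, worst-to-avg, circuit-lb): - technique_class: meta-complexity, NP-hardness, worst-to-avg, circuit-lb
- Literature.Barriers.PneNP.MCSPKarpHardness: APPLIES to KtlangNpHard, sharply — the threshold of
MK^tP[s] is tied to the input length, so every
length-regular deterministic many-one reduction to it is "natural" in Kabanets–Cai's sense
(deterministic hardness ⇒ EXP ≠ ZPP / EXP ⊄ P/poly-type
consequences, MurrayWilliams2017 Thms 1.6, 4.1; Ko1991: must be non-relativizing; Hirahara–Watanabe:
not oracle-independent). Evasion: the crux
asks two-sided RANDOMIZED many-one reductions with an exact polynomial coin budget (the notion in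
which Hirahara2022's MCSP*/MINKT* hardness is
proved and for which Murray–Williams record no consequence); honest: Mazor–Pass (ECCC:TR24-053)
exclude randomized LEVIN reductions under subexp
iO + OWF, so the reduction must also be non-witness-preserving, and a Saks–Santhanam-type upgrade to
plain randomized Karp reductions at fixed t
would put rank 2 back inside the barrier (Cheapest falsifier).
- Literature.Barriers.PneNP.NPHardnessToOneWayFunctions: APPLIES to KtlangWorstToAvg (conclusion
io-OWF) and bit the rev ≤ 3 form outright
(machine in negative position ⇒ via the planted U_J it WAS "OWF from NP ⊄ BPP", refuter block
2026-08-15): a non-adaptive black-box reduction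
basing OWF on NP-hardness gives coNP ⊆ AM (AGGM Thm 4; Bogdanov–Trevisan). Evasion: C3's antecedent
is X_BPP — hardness of a typed K^t slice for
EVERY machine, in positive position, which U_J does not collapse —

Novelty grade: known — ROUTE REVIEW + novelty (refuter-rreview1-PneNP-ktlang-b24f6602-0, 2026-08-15; searchd rc75 x2, galaxy 0 hits; graded on the route own 08-15 searches, 08-14 page-checked regrounds, my reading). NOVELTY known: X = worst-case hardness of K^poly (LiuPass2020 p.4, from OWF via KabanetsCai2000/ABK+06); #2 (refuter refuter-rreview1-PneNP-ktlang-b24f6602-0, 2026-08-15T18:30:03Z; prior: arXiv:2009.11514, Hirahara2018, Hirahara2022, doi:10.1145/3564246.3585130, doi:10.1007/978-3-031-78011-0_8, KabanetsCai2000, doi:10.1109/SFCS.2002.1181992, Ko1991, MurrayWilliams2017, CCC1995)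

History (route lifecycle, newest last):
- 2026-08-15T16:59:53Z · rev 3: restated KtlangWorstToAvg (stmt-PneNP-0051), Assembly (stmt-PneNP-0048) — route-repair (planner-rbadge-PneNP-ktlang-b24f6602-g2-0): deciding theorem `closes : KtlangThesis → PneNP` proved inline from the DISCHARGED facts nonempty_hold (planner-rbadge-PneNP-ktlang-b24f6602-g2-0)
- 2026-08-16T04:14:44Z · AUTO-CRUX (backfill): KtlangThesis — hypotheses of the deciding theorem that nothing in the route derives are cruxes (operator:999:1085951)
- 2026-08-16T05:28:52Z · rev 5: restated KtlangNpHard (stmt-PneNP-0049), KtlangWorstToAvg (stmt-PneNP-11283) — route-repair (g3) part 2/2 — statements+imports+closes: conjecture/debt-free import cone — drop OneWayFunctions/RandReductions/ClayProblem/NPBridge imports (6 u (planner-rbadge-PneNP-ktlang-b24f6602-g3-0)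
- 2026-08-16T05:28:52Z · rev 5: dropped KtlangKtHoa — route-repair (g3) part 2/2 — statements+imports+closes: conjecture/debt-free import cone — drop OneWayFunctions/RandReductions/ClayProblem/NPBridge imports (6 u (planner-rbadge-PneNP-ktlang-b24f6602-g3-0)
- 2026-08-21T17:29:29Z · DORMANT — reconciler: no traction for 5 d (last activity item-proof-filed at 2026-08-16T17:01:51Z); parked, not closed — `ledger route dormant route-PneNP-ktlang --off` t (operator:999:593504)

sub-problem: PneNP · status: dormant · opened planner-PneNP-plan-0 2026-08-13T05:47:47Z · rev 8 · ledger route-PneNP-ktlang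
GENERATED by the gate from the ledger (D-0016/17). Provers cite these decls: `theorem foo : Summit.PneNP.PneNP.Theses.Ktlang.<Decl> := …` in Summits/PneNP/PneNP/Theorems/<Name>.lean.
-/

namespace Summit.PneNP.PneNP.Theses.Ktlang

open scoped BigOperators Topology Manifold Classical MeasureTheory ProbabilityTheory Matrix InnerProductSpace ComplexConjugate ContinuousMap
open Filter Set Function TopologicalSpace MeasureTheory

attribute [summit_statement] _root_.PneNP

open Literature.PNP

/-- item stmt-PneNP-0047 · crux (kind.auto-crux: conjecture-grade) · rank 0 · open · by planner
why it might fail: s ∈ ℕ[X] leaves only thresholds s = n + c below U's print constant live (constant s: in P by enumeration; s ≥ n + c_U: everything); Ko1991 oracles put MINKT in P, so X is non-relativizing; ¬X for one U already refutes OWF (Liu–Pass + Kabanets–Cai) — X is at least P ≠ NP-hard to prove.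
sources: LiuPass2020 (arXiv:2009.11514) §1.1 pp. 3–5 and §2.2, Ko1991, KabanetsCai2000, doi:10.1109/SFCS.2002.1181992 (ABK+ 2006), decl Literature.Computability.MetaComplexity.UniversalMachine.print / ncard_setOf_ktAt_lt (threshold regime), decl Literature.Computability.Cryptography.MKtimeP_mem_NP_holds
Thesis X of route ktlang: deciding whether K^t(x) ≤ s(|x|) (Liu–Pass time-bounded Kolmogorov
complexity, MKtimeP) is not polynomial-time for some polynomial time bound t and threshold s, for
every U satisfying the UniversalMachine interface. Inhabitation of the interface is the separate
fact UniversalMachine.nonempty. Open. Sources: LiuPass2020, arXiv:2009.11514, Ko1991. -/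
@[route_item "route-PneNP-ktlang", crux]
def KtlangThesis : Prop :=
  ∀ U : Literature.Computability.MetaComplexity.UniversalMachine, ∃ (t s : Polynomial ℕ), U.MKtimeP (fun n => t.eval n) (fun n => s.eval n) ∉ Literature.Computability.Complexity.Classes.P

-- earlier KtlangNpHard (stmt-PneNP-0049, replaced 2026-08-16T05:28:52Z -> stmt-PneNP-14662): retired by None — ∀ U : Literature.Computability.MetaComplexity.UniversalMachine, ∃ (t s : Polynomial ℕ), (∀ n : ℕ, 2 * n ≤ t.eval n) ∧ Literature.Computability.MetaComplexity.IsRandNPHard (U.MKtimeP (fun n => t.eval n) (fun n => s.eval n))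
/-- item stmt-PneNP-14662 · crux · rank 2 · open · by planner
why it might fail: Only MCSP*/McKTP/distributional-K^t/oracle variants are known NP-hard (Hirahara22, LiuPass CCC22, Hirahara23, Ilango23); deterministic hardness forces EXP ≠ ZPP (MurrayWilliams2017 Thm 1.6); Gap-MKTP is not NP-complete under randomized LEVIN reductions given subexp iO + OWF (Mazor–Pass TR24-053).
sources: Hirahara2022, Hirahara2023 (doi:10.1145/3564246.3585130) Thm 1.2 and p. 4 (Saks–Santhanam obstacle), MurrayWilliams2017 Thms 1.6/4.1, KabanetsCai2000, HuangIlangoRen2023, doi:10.1007/978-3-030-41672-0_6 (Hirahara–Watanabe 2020 oracle-independence)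
[crux] For every efficient universal machine U some exact threshold language MK^tP[s] (t ≥ 2n; t, s
polynomials) is NP-hard under two-sided randomized polynomial-time many-one reductions that read
EXACTLY q(|x|) coins (Arora–Barak Def. 7.16 in the normal form of Def. 7.3). rev 4 (route-repair
g3): the reducibility is INLINED over `RandAlg` and is `Iff.rfl`-equal to `∀ L' ∈ NP,
Literature.Computability.MetaComplexity.PolyTimeRandReducible' L' (U.MKtimeP t s)`
(RandReductionsBPPProofs.lean; checked in Sketch.lean, rc 0) — it replaces rev ≤ 3's `IsRandNPHard`,
whose `PolyTimeRandReducible` only BOUNDS the coin budget and so leaks the advice bit [|x| ∈ S]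
(RandReductionsLeak.lean) and whose closure fact `mem_BPP_of_polyTimeRandReducible` is MIS-STATED;
with the corrected, PROVED closure `mem_BPP_of_polyTimeRandReducible'_holds` the crux gives X_BPP ⇔
NP ⊄ BPP (one-liner `PolyTimeRandReducible'.mem_BPP`). No RandReductions*.lean import is needed, so
the route cone stays debt-free. Open: NP-hardness is known for MCSP* (Hirahara FOCS 2022), McKTP
(Liu–Pass CCC 2022), distributional K^t (Hirahara STOC 2023 Thm 1.2), random-oracle variants (Ilango
FOCS 2023); Mazor–Pass (ECCC TR24-053): und -/
@[route_item "route-PneNP-ktlang"]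
def KtlangNpHard : Prop :=
  ∀ U : Literature.Computability.MetaComplexity.UniversalMachine, ∃ (t s : Polynomial ℕ), (∀ n : ℕ, 2 * n ≤ t.eval n) ∧ ∀ L' ∈ Literature.Computability.Complexity.Nondeterministic.NP, ∃ A : Literature.Computability.Complexity.RandAlg (List Bool) (List Bool), A.IsPolyTime id (id : List Bool → List Bool) ∧ (∃ q : Polynomial ℕ, ∀ n : ℕ, A.coinLen n = q.eval n) ∧ ∀ x : List Bool, 2 / 3 ≤ A.pr id x {y : List Bool | y ∈ U.MKtimeP (fun n => t.eval n) (fun n => s.eval n) ↔ x ∈ L'}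

-- earlier KtlangWorstToAvg (stmt-PneNP-0051, replaced 2026-08-15T16:59:53Z -> stmt-PneNP-11283): retired by None — ∀ U : Literature.Computability.MetaComplexity.UniversalMachine, (∃ (t s : Polynomial ℕ), (∀ n : ℕ, 2 * n ≤ t.eval n) ∧ U.MKtimeP (fun n => t.eval n) (fun n => s.eval n) ∉ Literature.Computability.Complexity.BPP) → Literature.Computability.Cryptography.OWFExist
-- earlier KtlangWorstToAvg (stmt-PneNP-11283, replaced 2026-08-16T05:28:52Z -> stmt-PneNP-14663): retired by None — ∀ U : Literature.Computability.MetaComplexity.UniversalMachine, (∃ (t s : Polynomial ℕ), (∀ n : ℕ, 2 * n ≤ t.eval n) ∧ U.MKtimeP (fun n => t.eval n) (fun n => s.eval n) ∉ Literature.Computability.Complexity.BPP) → ∃ f : List Bool → List Bool, Literature.Computability.Cryptography.IsOne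
/-- item stmt-PneNP-14663 · crux · rank 4 · open · by planner
why it might fail: X_BPP is worst-case hardness of an exact K^t slice; worst→avg reductions for K^poly are ERRORLESS (Hirahara2018), io-OWF needs error-prone avg hardness — open (LiuPass2020 p.5, Hirahara2023 §1.3); black-box ⇒ coNP ⊆ AM (Bogdanov–Trevisan); proved only for depth/boundary-restricted MK^tP (Liu–Pass).
sources: Hirahara2018 (doi:10.1109/focs.2018.00032), Hirahara2023 §1.3 (doi:10.1145/3564246.3585130), LiuPass2020 (arXiv:2009.11514) p. 5, doi:10.1007/978-3-031-78011-0_8 (Liu–Pass CRYPTO 2024 Thm 1.1 io-balanced), doi:10.1007/978-3-032-01855-7_20 (Liu–Pass 2025 — acq-05706), doi:10.4230/lipics.itcs.2026.97 (Liu–Pass ITCS 2026)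
[crux] C3 of the route-review block (refuter-rreview1-PneNP-ktlang-b24f6602-0, 2026-08-15,
concurring with 4 of 5 crux-attack seats on stmt-PneNP-11283; 'Unblock = route edit restating the
decl'): if thesis X holds in its BPP form — for EVERY efficient universal machine U some exact
threshold language MK^tP[s] with t ≥ 2n is worst-case hard for BPP (machine in POSITIVE position, so
the planted machine U_J of the block no longer collapses the statement to 'NP ⊄ BPP → OWF') — then
INFINITELY-OFTEN one-way functions exist (io-balanced conclusion: plain ∉ BPP is i.o.-type hardness,
so the honest conclusion is io-OWF, Hirahara–Lu–Oliveira 2024 Def. 10; the rev-3 a.e. conclusion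
forced the foreign conjunct IOOWFExist → OWFExist). rev 4 spelling: the conclusion `∃ f, IsIOOneWay
f` (= `Literature.Computability.Cryptography.IOOWFExist`, OneWayFunctions.lean:219/≈300, with
invertProb and uniformAvg) is INLINED down to `RandAlg.pr` and a finite average, `Iff.rfl`-equal to
the refuters' C3 (checked in the planner's Sketch.lean, rc 0), so that the route imports neither
OneWayFunctions.lean (home of the open conjectures OWFExist / WeakOWFExist / NonuniformOWFExist /
IOOWFExist) nor StatisticalDi -/
@[route_item "route-PneNP-ktlang"]
def KtlangWorstToAvg : Prop :=
  (∀ U : Literature.Computability.MetaComplexity.UniversalMachine, ∃ (t s : Polynomial ℕ), (∀ n : ℕ, 2 * n ≤ t.eval n) ∧ U.MKtimeP (fun n => t.eval n) (fun n => s.eval n) ∉ Literature.Computability.Complexity.BPP) → ∃ f : List Bool → List Bool, Literature.Computability.Complexity.PolyTimeComputable id id f ∧ ∀ A : Literature.Computability.Complexity.RandAlg (List Bool) (List Bool), A.IsPolyTime id (id : List Bool → List Bool) → ∀ c : ℕ, ∃ᶠ n in Filter.atTop, (∑ x : List.Vector Bool n, A.pr id (Literature.Computability.Complexity.boolPair (Computability.unaryEncodeNat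 n) (f x.toList)) {z : List Bool | f z = f x.toList}) / 2 ^ n ≤ 1 / (n : ℝ) ^ c

/-- item stmt-PneNP-0052 · crux · rank 5 · open · by planner
why it might fail: Implies NP ⊄ ACC⁰ (frontier: NQP ⊄ ACC⁰, MurrayWilliams2018). The PRG/hitting-set argument behind MCSP ∉ AC⁰, AC⁰[p] (ABK+06, GIIKKT19) needs at thresholds s = n + c a poly-time generator unpredictable by ACC⁰ at seed < n — an average-case ACC⁰ bound for P, unknown.
sources: Williams2014, MurrayWilliams2018, doi:10.1109/SFCS.2002.1181992 (ABK+ 2006), KabanetsCai2000, ECCC:TR19-018 (GIIKKT 2019), RazborovRudich1997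
Open. The AC⁰ analogue follows by the standard PRG argument (Allender–Buhrman–Koucký–van
Melkebeek–Ronneburger 2006: MK^tP[s] rejects most random strings but accepts every output of a
poly-time PRG with seed length < s − O(1), and Nisan's PRG fools AC⁰); AC⁰[p] analogues are theorems
for MCSP (Golovnev–Ilango–Impagliazzo–Kabanets–Kolokolova–Tal 2019). An ACC⁰ version needs a PRG (or
a non-PRG argument) against ACC⁰; since MK^tP ∈ NP it implies NP ⊄ ACC⁰ (route circuit #3). Sources:
KabanetsCai2000, ACM2014, RazborovRudich1997. -/
@[route_item "route-PneNP-ktlang"]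
def KtlangAcc0 : Prop :=
  ∀ U : Literature.Computability.MetaComplexity.UniversalMachine, ∃ (t s : Polynomial ℕ), (∀ n : ℕ, 2 * n ≤ t.eval n) ∧ U.MKtimeP (fun n => t.eval n) (fun n => s.eval n) ∉ Literature.Computability.Complexity.ACC0

/-- item stmt-PneNP-0053 · support · rank 6 · open · by planner
sources: Ko1991, KabanetsCai2000, LiuPass2020
Negation of the thesis, filed so the negative side is staffed. If proved, OWF do not exist
(Liu–Pass) and route ktlang closes. Sources: LiuPass2020, KabanetsCai2000. -/
@[route_item "route-PneNP-ktlang"]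
def KtlangNeg : Prop :=
  ∃ U : Literature.Computability.MetaComplexity.UniversalMachine, ∀ (t s : Polynomial ℕ), U.MKtimeP (fun n => t.eval n) (fun n => s.eval n) ∈ Literature.Computability.Complexity.Classes.P

-- earlier Assembly (stmt-PneNP-0048, replaced 2026-08-15T16:59:53Z -> stmt-PneNP-11284): retired by None — Literature.Computability.Complexity.P_bool_eq → Literature.Computability.Complexity.NP_bool_eq → Literature.Computability.MetaComplexity.UniversalMachine.nonempty → Literature.Computability.Cryptography.MKtimeP_mem_NP → (∀ U : Literature.Computability.MetaComplexity.UniversalMachine, ∃ (t s : P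
/-- item stmt-PneNP-11284 · assembly · rank 1 · closed · proved by Summit.PneNP.PneNP.Theorems.ktlang_assembly_proof @ 7d15697e3da9 (prover) · by planner
[assembly] rev 3 (route-repair): X → PneNP with NO Literature-fact hypotheses — the four facts of
the rev ≤ 2 assembly (P_bool_eq, NP_bool_eq, UniversalMachine.nonempty, MKtimeP_mem_NP) are
DISCHARGED in tree (P_bool_eq_holds, np_bool_eq / NP_bool_eq_holds, UniversalMachine.nonempty_holds,
MKtimeP_mem_NP_holds) and are consumed inside the proof, not assumed. Provable now: `fun hX =>
Summit.PneNP.PneNP.Theses.Ktlang.closes hX` (the deciding theorem of this file), or adapt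
Theorems/KtlangAssembly.lean (`Literature.CplxMeta.ktlang_assembly`, p3336) by feeding it the four
`_holds` witnesses. Kept as an item only because assembly items are not droppable; the deciding
theorem does not use it. [difficulty: provable-now] Sources: LiuPass2020 §2.2, CookClay2006 §1,
AroraBarak2009 Thm 1.9. -/
@[route_item "route-PneNP-ktlang"]
def Assembly : Prop :=
  KtlangThesis → PneNP

/-! D-0027 §2.1 — DECIDING THEOREM (planner-authored via `route open/edit --closes-file`; by planner-rbadge-PneNP-ktlang-b24f6602-g4-0 2026-08-16T06:14:23Z):
its hypotheses are this route's items and its conclusion the sub-problem Statement (glue_lint), and it elaborates with this file. -/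

-- D-0027 §2.1 deciding theorem of route-PneNP-ktlang (route-repair rev 4, planner-rbadge-PneNP-ktlang-b24f6602-g3-0, 2026-08-16):
-- X alone decides Cook's statement, through a CONJECTURE-FREE import cone. Pick U from the DISCHARGED construction fact
-- `UniversalMachine.nonempty_holds` (Hennie–Stearns; UniversalMachineProofs), take the (t, s) of X, get `MK^tP[s] ∈ NP` from the
-- DISCHARGED sanity fact `MKtimeP_mem_NP_holds` (Liu–Pass 2020 §2.2; CryptoFoundationsKolmogorovProofs), `∉ P` from X, and transport to
-- the Clay classes by the bridges of `CookBridges.lean` (`CookBridges.np_bool_eq`, `p_bool_eq`), the twins of NPBridge/ClayProblem that sit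
-- below no open conjecture (ClayProblem.lean registers `NPNotSubsetPPoly`).
@[closes "route-PneNP-ktlang"] theorem closes (hX : KtlangThesis) : _root_.PneNP := by
  obtain ⟨U⟩ := Literature.Computability.MetaComplexity.UniversalMachine.nonempty_holds
  obtain ⟨t, s, h⟩ := hX U
  show ∃ L, L ∈ Literature.Computability.Complexity.PNPWave0.NP Bool ∧ L ∉ Literature.Computability.Complexity.PNPWave0.P Bool
  refine ⟨U.MKtimeP (fun n => t.eval n) (fun n => s.eval n), ?_, ?_⟩
  · rw [Literature.Computability.Complexity.CookBridges.np_bool_eq]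
    exact Literature.Computability.Cryptography.MKtimeP_mem_NP_holds U t s
  · rw [Literature.Computability.Complexity.p_bool_eq]
    exact h

end Summit.PneNP.PneNP.Theses.Ktlang
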